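import Mathlib
import Literature.AlgebraicGeometry.Resolution.ReflexiveModulesRationalDoublePoints
import Literature.AlgebraicGeometry.Resolution.FundamentalLocus
import Literature.AlgebraicGeometry.Resolution.FiniteBirationalNormal
import Literature.AlgebraicGeometry.Motives.CartierDivisor
import Summits.ResolutionOfSingularities.ResolutionOfSingularities.Theorems.HomologicalConductorNoZenoFullSheaf
import Summits.ResolutionOfSingularities.ResolutionOfSingularities.Theorems.HomologicalConductorNoZenoReflexiveHeightOne
import HarnessLib

/-!
# Full sheaves: stalks over valuation points of the base, and Hartogs for reflexive lattices
# (G2 (ii)/(iv) input, chain W4.4)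

`[OURS · L W4.4]` Crux `HomologicalConductor.NoZenoR` (stmt-ResolutionOfSingularities-19943; twin `NoZeno`
stmt-16483), line `sandwich-cluster`, S3 Layer 2, G-layer item **G2 (full-sheaf package)** over
res-D-pv-045 AS res-L0-w44-stub-8's OBJECT `FullSheaf.generatedSheaf V S = «𝒪_X · S ⊆ V_X»` (p500643),
clauses (ii) `Ȟ⁰(X, M̃) = φ(M)` (res-D-pv-053) and (iv) «`M̃` locally free» (this seat; holder's cut
2026-08-27T06:00:41Z).  For `π : X ⟶ Spec T` (`X` integral) the base ring acts on a `K(X)`-vector space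
`V` through `baseToFunctionField π : T → K(X)`; the stalk lattices are `stalkSpan V S x = 𝒪_{X,x} · S`.

* `toFunctionField_stalkMap_germ_top` — the composite `T ≅ Γ(Spec T) → 𝒪_{Spec T, π x} → 𝒪_{X,x} ↪ K(X)`
  is `baseToFunctionField π`;
* `exists_mul_base_eq_base_of_isIso_stalkMap` — if the stalk map `𝒪_{Spec T, π x} → 𝒪_{X,x}` is an
  isomorphism, every element of `𝒪_{X,x} ⊆ K(X)` is a fraction `a/s` of elements of `T` with
  `s ∉ π x` («`𝒪_{X,x} = T_{π x}` inside `K(X)`»);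
* `exists_smul_mem_of_mem_stalkSpan` — hence a vector of `𝒪_{X,x} · N` (`N` a `T`-submodule of `V`)
  has a multiple `s • v ∈ N` with `s ∉ π x`;
* `exists_base_eq_and_isIso_stalkMap` — for `π` PROPER BIRATIONAL, over every point `p` of `Spec T`
  whose local ring is a valuation ring there is a point `x` with `π x = p` and `𝒪_{Spec T,p} ≅ 𝒪_{X,x}`
  (tree `FundamentalLocus.isIso_stalkMap_of_valuationRing_stalk`, surjectivity of proper birational maps);
  `valuationRing_stalk_of_height_le_one` — for `T` a noetherian NORMAL domain the local rings of
  `Spec T` at primes of height `≤ 1` are valuation rings;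
* **`mem_of_forall_height_le_one_mem_stalkSpan`** — HARTOGS FOR FULL SHEAVES: `T` a noetherian normal
  domain, `π` proper birational, `N ≤ V` a REFLEXIVE `T`-submodule; a vector lying in `𝒪_{X,x} · N` for
  every `x` over a prime of height `≤ 1` lies in `N` (⟸ `mem_of_isReflexive_of_forall_height_eq_one`,
  p499909); `mem_range_of_forall_height_le_one_mem_stalkSpan` — the same in the G2 convention
  `S = Set.range φ`, `φ : M →+ (Fin r → K(X))` injective and `T`-semilinear, `M` reflexive: the `⊆`
  half of (ii), in the sharper «height ≤ 1 points only» form that (iv) needs.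

Replaces the role of no printed item of the manuscript under review (Hironaka 2017); AI-written,
weaker than expert review. [cite: ArtinVerdier1985, p. 79 (the full sheaf)]; [cite: Matsumura1987,
Thm. 11.5 (ii)]
-/

-- single-problem summit: the doubled namespace component `ResolutionOfSingularities` is forced
set_option linter.dupNamespace false

noncomputable section

universe u

open CategoryTheory AlgebraicGeometry TopologicalSpace Opposite
open Literature.AlgebraicGeometry.Resolution Literature.AlgebraicGeometry.Motives

namespace Summit.ResolutionOfSingularities.ResolutionOfSingularities.Theorems.NoZeno.SandwichCluster.FullSheaf

variable {X : Scheme.{u}} [IsIntegral X] {T : Type u} [CommRing T] (π : X ⟶ Spec (.of T))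

/-! ## The composite `T → 𝒪_{Spec T, π x} → 𝒪_{X,x} → K(X)` -/

/-- `T ≅ Γ(Spec T, ⊤) —germ→ 𝒪_{Spec T, π x} —π^♯_x→ 𝒪_{X,x} ↪ K(X)` is `baseToFunctionField π` (germs
of a global function agree in `K(X)`). [folklore] -/
theorem toFunctionField_stalkMap_germ_top (x : X) (a : T) :
    RatFn.toFunctionField x (π.stalkMap x ((Spec (.of T)).presheaf.germ ⊤ (π.base x) trivial
      ((Scheme.ΓSpecIso (.of T)).inv a))) = baseToFunctionField π a := by
  rw [Scheme.Hom.germ_stalkMap_apply]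
  change RatFn.toFunctionField x (X.presheaf.germ ⊤ x trivial
      (Literature.AlgebraicGeometry.Morphisms.algebraMapΓ π a)) =
    X.presheaf.germ ⊤ (genericPoint X) trivial (Literature.AlgebraicGeometry.Morphisms.algebraMapΓ π a)
  exact RatFn.toFunctionField_germ (Set.mem_univ x) _

/-- The germ of `a ∈ T` at `p ∈ Spec T` is the image of `a` in `T_p` under `Spec.stalkIso`.
[folklore] -/
theorem stalkIso_inv_algebraMap (p : Spec (.of T)) (a : T) :
    (Spec.stalkIso (.of T) p).inv (algebraMap T (Localization.AtPrime p.asIdeal) a) =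
      (Spec (.of T)).presheaf.germ ⊤ p trivial ((Scheme.ΓSpecIso (.of T)).inv a) := by
  have h := Spec.algebraMap_stalkIso_inv p
  have := congrArg (fun φ => φ.hom a) h
  simpa only [CommRingCat.hom_comp, RingHom.comp_apply, CommRingCat.hom_ofHom] using this

/-- **`𝒪_{X,x} = T_{π x}` inside `K(X)` when the stalk map is an isomorphism**: every element of
`𝒪_{X,x}` is `a / s` with `a, s ∈ T`, `s ∉ π x`. [folklore] -/
theorem exists_mul_base_eq_base_of_isIso_stalkMap (x : X) [IsIso (π.stalkMap x)]
    (t : X.presheaf.stalk x) :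
    ∃ a s : T, s ∉ (π.base x).asIdeal ∧
      RatFn.toFunctionField x t * baseToFunctionField π s = baseToFunctionField π a := by
  let p := π.base x
  let L := Localization.AtPrime p.asIdeal
  let e := Spec.stalkIso (.of T) p
  -- pull `t` back to `𝒪_{Spec T, p} ≅ T_p` and write it as a fraction
  let u : (Spec (.of T)).presheaf.stalk p := inv (π.stalkMap x) t
  obtain ⟨⟨a, s⟩, has⟩ := IsLocalization.surj p.asIdeal.primeCompl (e.hom u)
  refine ⟨a, s, s.2, ?_⟩
  -- back through `e.inv`: `u * germ s = germ a`
  have h1 : u * e.inv (algebraMap T L s) = e.inv (algebraMap T L a) := by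
    have := congrArg e.inv has
    rw [map_mul] at this
    rwa [← CommRingCat.comp_apply, e.hom_inv_id, CommRingCat.id_apply] at this
  rw [stalkIso_inv_algebraMap, stalkIso_inv_algebraMap] at h1
  -- apply `π^♯_x` and read in `K(X)`
  have h2 := congrArg (fun w => RatFn.toFunctionField x (π.stalkMap x w)) h1
  simp only [map_mul] at h2
  have hut : π.stalkMap x u = t := by
    change (inv (π.stalkMap x) ≫ π.stalkMap x) t = t
    rw [IsIso.inv_hom_id]; rfl
  rw [hut, toFunctionField_stalkMap_germ_top, toFunctionField_stalkMap_germ_top] at h2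
  exact h2

/-! ## `T`-submodules of `V` (the action of `T` through `baseToFunctionField π`) -/

variable {V : Type u} [AddCommGroup V] [Module X.functionField V] [Module T V]

-- NB: `FullSheaf.stalkModule` is NOT made a local instance in this file: as an instance with a free
-- point argument it also matches scalars in `K(X) = 𝒪_{X,ξ}` (the stalk at the generic point) and then
-- hijacks the genuine `K(X)`-action on concrete carriers such as `Fin r → K(X)`; it is introduced by
-- `letI` at a fixed point inside proofs instead.

/-- **A vector of `𝒪_{X,x} · N` has a multiple in `N` by a scalar outside `π x`**, when
`𝒪_{Spec T, π x} ≅ 𝒪_{X,x}`; here `T` acts on `V` through `baseToFunctionField π` (hypothesis `hmod`)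
and `N` is a `T`-submodule of `V`. [folklore] -/
theorem exists_smul_mem_of_mem_stalkSpan (hmod : ∀ (a : T) (v : V), a • v = baseToFunctionField π a • v)
    (x : X) [IsIso (π.stalkMap x)] (N : Submodule T V) {v : V} (hv : v ∈ stalkSpan V (N : Set V) x) :
    ∃ s : T, s ∉ (π.base x).asIdeal ∧ s • v ∈ N := by
  letI := stalkModule V x
  have h1 : (1 : T) ∉ (π.base x).asIdeal := (Ideal.ne_top_iff_one _).mp (π.base x).2.ne_top
  induction hv using Submodule.span_induction with
  | mem w hw => exact ⟨1, h1, by rw [one_smul]; exact hw⟩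
  | zero => exact ⟨1, h1, by rw [smul_zero]; exact N.zero_mem⟩
  | add w w' _ _ hw hw' =>
    obtain ⟨s, hs, hsw⟩ := hw
    obtain ⟨s', hs', hsw'⟩ := hw'
    refine ⟨s * s', fun h => ((π.base x).2.mem_or_mem h).elim hs hs', ?_⟩
    rw [smul_add, mul_comm s s', mul_smul, mul_smul]
    exact N.add_mem (N.smul_mem _ hsw) (by rw [smul_comm]; exact N.smul_mem _ hsw')
  | smul t w _ hw =>
    obtain ⟨s, hs, hsw⟩ := hw
    obtain ⟨a, s', hs', hts'⟩ := exists_mul_base_eq_base_of_isIso_stalkMap π x t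
    refine ⟨s' * s, fun h => ((π.base x).2.mem_or_mem h).elim hs' hs, ?_⟩
    -- `(s' s) • (t • w) = a • (s • w)`
    have : ((s' * s : T) • (t • w) : V) = (a : T) • (s • w) := by
      rw [stalk_smul_def, hmod, hmod, hmod, smul_smul, smul_smul, map_mul,
        mul_comm (baseToFunctionField π s') (baseToFunctionField π s), mul_assoc,
        mul_comm (baseToFunctionField π s'), hts', mul_comm]
    rw [this]
    exact N.smul_mem _ hsw

/-! ## Points over the valuation points of the base -/

/-- **Over a valuation point of the base a proper birational morphism has a point with isomorphic
local ring**: if `𝒪_{Spec T, p}` is a valuation ring, there is `x ∈ X` with `π x = p` and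
`𝒪_{Spec T,p} ≅ 𝒪_{X,x}` (surjectivity of the proper dominant `π` + tree
`FundamentalLocus.isIso_stalkMap_of_valuationRing_stalk`). [cite: Piltant2013, §2] -/
theorem exists_base_eq_and_isIso_stalkMap [IsDomain T] [IsProper π] (hπ : IsBirational π)
    (p : Spec (.of T))
    (hp : ValuationRing ((Spec (.of T)).presheaf.stalk p)) :
    ∃ x : X, π.base x = p ∧ IsIso (π.stalkMap x) := by
  haveI : IsDominant π := hπ.isDominant
  -- `π` is surjective: dominant with closed image
  have hsurj : Function.Surjective π.base := by
    rw [← Set.range_eq_univ, ← π.isClosedMap.isClosed_range.closure_eq]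
    exact π.denseRange.closure_range
  obtain ⟨x, rfl⟩ := hsurj p
  exact ⟨x, rfl, isIso_stalkMap_of_valuationRing_stalk π hπ.isIso_stalkMap_genericPoint x hp⟩

/-- **The local rings of `Spec T` at primes of height `≤ 1` are valuation rings**, for `T` a
noetherian NORMAL domain (a normal noetherian local domain of dimension `≤ 1` is a field or a DVR).
[cite: Matsumura1987, Thm. 11.2] -/
theorem valuationRing_stalk_of_height_le_one [IsDomain T] [IsNoetherianRing T] [IsIntegrallyClosed T]
    (p : Spec (.of T)) (hp : p.asIdeal.height ≤ 1) :
    ValuationRing ((Spec (.of T)).presheaf.stalk p) := by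
  let S : Type u := (Spec (.of T)).presheaf.stalk p
  letI : Algebra T S := StructureSheaf.stalkAlgebra T p
  haveI : IsLocalization.AtPrime S p.asIdeal := StructureSheaf.IsLocalization.to_stalk T p
  haveI : IsDomain S :=
    IsLocalization.isDomain_of_le_nonZeroDivisors S p.asIdeal.primeCompl_le_nonZeroDivisors
  haveI : IsNoetherianRing S := IsLocalization.isNoetherianRing p.asIdeal.primeCompl S inferInstance
  haveI : IsLocalRing S := IsLocalization.AtPrime.isLocalRing S p.asIdeal
  haveI : IsIntegrallyClosed S :=
    isIntegrallyClosed_of_isLocalization S p.asIdeal.primeCompl p.asIdeal.primeCompl_le_nonZeroDivisors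
  have h : ValuationRing S := by
    refine valuationRing_of_isIntegrallyClosed_of_ringKrullDim_le_one S ?_
    rw [IsLocalization.AtPrime.ringKrullDim_eq_height p.asIdeal S]
    exact_mod_cast hp
  exact h

/-! ## Hartogs for reflexive lattices: sections off the closed fibre -/

/-- `baseToFunctionField π` read through any stalk: `a ↦ 𝒪_{X,x}`-germ of `a`, then into `K(X)`.
[folklore] -/
theorem baseToFunctionField_eq_toFunctionField_stalkMap (x : X) (a : T) :
    baseToFunctionField π a = RatFn.toFunctionField x (π.stalkMap x
      ((Spec.stalkIso (.of T) (π.base x)).inv (algebraMap T (Localization.AtPrime (π.base x).asIdeal) a))) := by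
  rw [stalkIso_inv_algebraMap, toFunctionField_stalkMap_germ_top]

/-- `baseToFunctionField π` is injective as soon as some stalk map of `π` is an isomorphism (e.g. at
the generic point, for `π` birational) and `T` is a domain. [folklore] -/
theorem baseToFunctionField_injective [IsDomain T] (x : X) [IsIso (π.stalkMap x)] :
    Function.Injective (baseToFunctionField π) := by
  intro a b hab
  rw [baseToFunctionField_eq_toFunctionField_stalkMap π x,
    baseToFunctionField_eq_toFunctionField_stalkMap π x] at hab
  have h1 := RatFn.toFunctionField_injective x hab
  have h2 := ((ConcreteCategory.isIso_iff_bijective (π.stalkMap x)).mp inferInstance).1 h1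
  have h3 := (Spec.stalkIso (.of T) (π.base x)).commRingCatIsoToRingEquiv.symm.injective h2
  exact IsLocalization.injective (Localization.AtPrime (π.base x).asIdeal)
    (π.base x).asIdeal.primeCompl_le_nonZeroDivisors h3

/-! ## Hartogs for reflexive lattices -/

/-- `V` is torsion-free as a `T`-module (through the injective `baseToFunctionField π`). [folklore] -/
theorem noZeroSMulDivisors_of_base [IsDomain T] (hη : IsIso (π.stalkMap (genericPoint X)))
    (hmod : ∀ (a : T) (v : V), a • v = baseToFunctionField π a • v) : NoZeroSMulDivisors T V := by
  haveI := hη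
  refine ⟨fun {a v} h => ?_⟩
  rw [hmod] at h
  rcases smul_eq_zero.mp h with h | h
  · left
    exact baseToFunctionField_injective π (genericPoint X) (by rw [h, map_zero])
  · exact Or.inr h

/-- **HARTOGS FOR FULL SHEAVES.**  `T` a noetherian NORMAL domain, `π : X ⟶ Spec T` proper and
birational (`X` integral), `T` acting on the `K(X)`-vector space `V` through `baseToFunctionField π`,
and `N ≤ V` a REFLEXIVE `T`-submodule.  A vector `v` lying in the stalk lattice `𝒪_{X,x} · N` for every
point `x` over a prime of `T` of height `≤ 1` lies in `N`: over such a prime `𝒪_{X,x} = T_𝔭`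
(`exists_base_eq_and_isIso_stalkMap`), so `v ∈ N_𝔭` for all height-one `𝔭` (and `v ∈ K·N`), and a
reflexive module is the intersection of its height-one localisations
(`mem_of_isReflexive_of_forall_height_eq_one`, p499909). [cite: Matsumura1987, Thm. 11.5 (ii)] -/
theorem mem_of_forall_height_le_one_mem_stalkSpan [IsDomain T] [IsNoetherianRing T]
    [IsIntegrallyClosed T] [IsProper π] (hπ : IsBirational π)
    (hmod : ∀ (a : T) (v : V), a • v = baseToFunctionField π a • v)
    (N : Submodule T V) [Module.IsReflexive T N] {v : V}
    (h : ∀ x : X, (π.base x).asIdeal.height ≤ 1 → v ∈ stalkSpan V (N : Set V) x) : v ∈ N := by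
  haveI : NoZeroSMulDivisors T V := noZeroSMulDivisors_of_base π hπ.isIso_stalkMap_genericPoint hmod
  -- over every prime of height `≤ 1` the vector has a multiple in `N`
  have key : ∀ P : Ideal T, P.IsPrime → P.height ≤ 1 → ∃ s ∉ P, s • v ∈ N := by
    intro P hP hP1
    let p : Spec (.of T) := ⟨P, hP⟩
    obtain ⟨x, hx, hiso⟩ :=
      exists_base_eq_and_isIso_stalkMap π hπ p (valuationRing_stalk_of_height_le_one p hP1)
    haveI := hiso
    have hv : v ∈ stalkSpan V (N : Set V) x := h x (by rw [hx]; exact hP1)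
    obtain ⟨s, hs, hsv⟩ := exists_smul_mem_of_mem_stalkSpan π hmod x N hv
    rw [hx] at hs
    exact ⟨s, hs, hsv⟩
  obtain ⟨s₀, hs₀, hv₀⟩ := key ⊥ Ideal.isPrime_bot (by rw [Ideal.height_bot]; exact bot_le)
  rw [Submodule.mem_bot] at hs₀
  exact mem_of_isReflexive_of_forall_height_eq_one N hs₀ hv₀ fun P hP hP1 => key P hP hP1.le

/-- **The `⊆` half of G2 (ii), in the sharper «height `≤ 1` points» form** (the G2 convention of
res-D-pv-045's `SketchG2Split`: `M` a reflexive `T`-module, `φ : M →+ K(X)^r` injective and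
`T`-semilinear along `baseToFunctionField π`, full sheaf `M̃ = 𝒪_X · φ(M)`): a vector lying in the stalk
lattice `𝒪_{X,x} · φ(M)` at every point `x` over a prime of height `≤ 1` lies in `φ(M)`.  In particular
`Γ(X, M̃) = φ(M)` ((ii)), and a section of `M̃` over the complement of finitely many closed points of the
closed fibre extends (the input of (iv)). [cite: ArtinVerdier1985, Lemma (1.1) (i)];
[cite: Matsumura1987, Thm. 11.5 (ii)] -/
theorem mem_range_of_forall_height_le_one_mem_stalkSpan [IsDomain T] [IsNoetherianRing T]
    [IsIntegrallyClosed T] [IsProper π] (hπ : IsBirational π)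
    {M : Type u} [AddCommGroup M] [Module T M] (hM : Module.IsReflexive T M) {r : ℕ}
    (φ : M →+ (Fin r → X.functionField))
    (hφ : ∀ (a : T) (m : M), φ (a • m) = baseToFunctionField π a • φ m)
    (hφinj : Function.Injective φ) {v : Fin r → X.functionField}
    (h : ∀ x : X, (π.base x).asIdeal.height ≤ 1 →
      v ∈ stalkSpan (Fin r → X.functionField) (Set.range φ) x) :
    v ∈ Set.range φ := by
  letI : Module T (Fin r → X.functionField) :=
    Module.compHom (Fin r → X.functionField) (baseToFunctionField π)
  have hmod : ∀ (a : T) (w : Fin r → X.functionField), a • w = baseToFunctionField π a • w :=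
    fun a w => (rfl : (baseToFunctionField π a) • w = (baseToFunctionField π a) • w)
  let φₗ : M →ₗ[T] (Fin r → X.functionField) :=
    { toFun := φ
      map_add' := φ.map_add
      map_smul' := fun a m => by rw [RingHom.id_apply, hφ]; rfl }
  haveI := hM
  haveI : Module.IsReflexive T (LinearMap.range φₗ) :=
    Module.equiv (LinearEquiv.ofInjective φₗ hφinj)
  have hN : ((LinearMap.range φₗ : Submodule T (Fin r → X.functionField)) : Set _) = Set.range φ :=
    LinearMap.coe_range φₗ
  have hv : v ∈ LinearMap.range φₗ :=
    mem_of_forall_height_le_one_mem_stalkSpan π hπ hmod (LinearMap.range φₗ) fun x hx => by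
      rw [hN]; exact h x hx
  exact LinearMap.mem_range.mp hv

end Summit.ResolutionOfSingularities.ResolutionOfSingularities.Theorems.NoZeno.SandwichCluster.FullSheaf

end
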